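import Literature.AlgebraicGeometry.Resolution.NormalizationInExtensionGenericPoint
import Literature.AlgebraicGeometry.Motives.CartierDivisor

/-!
# The function field of the normalization of `W` in a finite extension `L ⊇ K(W)` is `L`

Stub `stub_functionField_normalizationIn` of the crux `Picover` (summit
`ResolutionOfSingularities`, thesis `PAlteration`, line `degree-p-tower`). For an integral scheme
`W` and a finite field extension `L` of its function field `K(W)`, the function field of the
normalization `W^L = normalizationIn W L` of `W` in `L` (Mathlib's relative normalization of
`ξ_L : Spec L → Spec K(W) → W`, `fromSpecExtension W L`) is `L`, compatibly with `K(W) → L`: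

  `∃ e : K(W^L) ≃+* L, e ∘ ι^♯ = algebraMap K(W) L`,

where `ι = normalizationInι W L : W^L → W` is the normalization morphism and
`ι^♯ = RatFn.functionFieldMap ι : K(W) → K(W^L)` the induced map of function fields. This is the
clause "`K(X') = L`" of Q. Liu, *Algebraic Geometry and Arithmetic Curves* (2002), Def. 4.1.24 /
Prop. 4.1.25, in the form consumed by the line `degree-p-tower`.

## Proof

Let `q : Spec L → W^L` be Mathlib's `Scheme.Hom.toNormalization` of `ξ_L`, so that
`q ≫ ι = ξ_L`. It is dominant, and a preimmersion (`isPreimmersion_toNormalization`; this is where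
the finiteness of `L/K(W)` enters), so `q^♯ : K(W^L) → K(Spec L)` is surjective (it is the stalk
map of `q` at the point of `Spec L`, up to the identity specialization `𝒪_{W^L, η} = K(W^L)`) and
injective (a homomorphism of fields): `e₁ : K(W^L) ≃ K(Spec L)`. The function field of `Spec L`
(the stalk at its unique point) is identified with `L` by the germ map
`e₂ : L = Γ(Spec L, ⊤) ≅ 𝒪_{Spec L, η}` (Mathlib `stalkClosedPointIso`). Then `e := e₂⁻¹ ∘ e₁`,
and the compatibility follows from functoriality `q^♯ ∘ ι^♯ = (q ≫ ι)^♯ = ξ_L^♯`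
(`RatFn.functionFieldMap_comp`) and the computation of `ξ_L^♯` on germs: for a section `s` over a
non-empty open `U ⊆ W`, `ξ_L^♯(s_η)` is the germ of `ξ_L^*(s) ∈ Γ(Spec L, ξ_L⁻¹U)`, which is the
restriction of `(K(W) → L)(s_η) ∈ L = Γ(Spec L, ⊤)` (`fromSpecExtension_app_apply`).

## Sources

* Q. Liu, *Algebraic Geometry and Arithmetic Curves*, OUP (2002), Def. 4.1.24, Prop. 4.1.25.
-/

noncomputable section

set_option linter.dupNamespace false -- mandated namespace of this single-conjunct summit

open CategoryTheory AlgebraicGeometry TopologicalSpace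
open Literature.AlgebraicGeometry.Resolution Literature.AlgebraicGeometry.Motives

namespace Summit.ResolutionOfSingularities.ResolutionOfSingularities.Theorems.Picover.FunctionFieldNormalizationIn

/-! ### The function field of `Spec L` -/

/-- For a field `L` and any point `p` of `Spec L` (there is exactly one), the germ map
`L = Γ(Spec L, ⊤) → 𝒪_{Spec L, p}` is bijective (Mathlib `stalkClosedPointIso`). [folklore] -/
theorem bijective_ΓSpecIso_inv_germ (L : Type) [Field L] (p : ↥(Spec (.of L))) :
    Function.Bijective ((Scheme.ΓSpecIso (.of L)).inv ≫
      (Spec (.of L)).presheaf.germ ⊤ p trivial) := by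
  obtain rfl : p = IsLocalRing.closedPoint L := Subsingleton.elim (α := PrimeSpectrum L) _ _
  have h : (Scheme.ΓSpecIso (.of L)).inv ≫
      (Spec (.of L)).presheaf.germ ⊤ (IsLocalRing.closedPoint L) trivial =
        (stalkClosedPointIso (.of L)).inv := by
    rw [Iso.inv_comp_eq]
    exact (ΓSpecIso_hom_stalkClosedPointIso_inv (.of L)).symm
  rw [h]
  exact ConcreteCategory.bijective_of_isIso _

/-! ### Function fields along dominant preimmersions -/

/-- `RatFn.functionFieldMap` only depends on the morphism (congruence through the `IsDominant`
instance argument). [folklore] -/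
theorem functionFieldMap_congr {X' X : Scheme.{0}} [IsIntegral X'] [IsIntegral X] {f g : X' ⟶ X}
    [IsDominant f] [IsDominant g] (h : f = g) :
    RatFn.functionFieldMap f = RatFn.functionFieldMap g := by
  subst h
  rfl

/-- For a dominant preimmersion `q : V → N` of integral schemes, `q^♯ : K(N) → K(V)` is bijective:
injective as a homomorphism of fields, surjective since the stalk maps of `q` are. [folklore] -/
theorem functionFieldMap_bijective_of_isPreimmersion {V N : Scheme.{0}} [IsIntegral V]
    [IsIntegral N] (q : V ⟶ N) [IsPreimmersion q] [IsDominant q] :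
    Function.Bijective (RatFn.functionFieldMap q) := by
  refine ⟨(RatFn.functionFieldMap q).injective, ?_⟩
  have hη : q (genericPoint V) = genericPoint N := RatFn.genericPoint_eq_of_isDominant q
  haveI : IsIso (N.presheaf.stalkSpecializes (RatFn.specializes_genericPoint q)) := by
    have key : ∀ (y : N) (h : y ⤳ genericPoint N), y = genericPoint N →
        IsIso (N.presheaf.stalkSpecializes h) := by
      rintro y h rfl
      rw [show N.presheaf.stalkSpecializes h = 𝟙 _ from
        TopCat.Presheaf.stalkSpecializes_refl _ _]
      infer_instance
    exact key _ _ hη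
  change Function.Surjective ((N.presheaf.stalkSpecializes (RatFn.specializes_genericPoint q) ≫
    q.stalkMap (genericPoint V)).hom)
  rw [CommRingCat.hom_comp, RingHom.coe_comp]
  exact (q.stalkMap_surjective (genericPoint V)).comp (ConcreteCategory.bijective_of_isIso
    (N.presheaf.stalkSpecializes (RatFn.specializes_genericPoint q))).2

/-! ### The map of function fields of `ξ_L : Spec L → W` -/

section

variable {W : Scheme.{0}} [IsIntegral W] {L : Type} [Field L] [Algebra W.functionField L]

/-- Over a non-empty open `U ⊆ W`, the identification `L ≅ Γ(Spec L, ξ_L⁻¹U)`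
(`extensionIsoSections`) followed by the germ at a point `p` is the germ map
`L = Γ(Spec L, ⊤) → 𝒪_{Spec L, p}`. [folklore] -/
theorem extensionIsoSections_hom_germ {U : W.Opens} (hU : (U : Set W).Nonempty)
    (p : ↥(Spec (.of L))) (hp : p ∈ fromSpecExtension W L ⁻¹ᵁ U) :
    (extensionIsoSections (X := W) (L := L) hU).hom ≫ (Spec (.of L)).presheaf.germ _ p hp =
      (Scheme.ΓSpecIso (.of L)).inv ≫ (Spec (.of L)).presheaf.germ ⊤ p trivial := by
  simp only [extensionIsoSections, Iso.trans_hom, Iso.symm_hom, asIso_hom, Category.assoc,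
    TopCat.Presheaf.germ_res]

/-- **`ξ_L^♯ : K(W) → K(Spec L)` is `K(W) → L` followed by the germ map `L → 𝒪_{Spec L, η}`**:
on the germ of a section `s` over a non-empty open `U`, `ξ_L^♯(s_η)` is the germ of `ξ_L^*(s)`,
computed by `fromSpecExtension_app_apply`. [folklore] -/
theorem functionFieldMap_fromSpecExtension_apply (a : W.functionField) :
    RatFn.functionFieldMap (fromSpecExtension W L) a =
      ((Scheme.ΓSpecIso (.of L)).inv ≫ (Spec (.of L)).presheaf.germ ⊤
        (genericPoint (Spec (.of L))) trivial) (algebraMap W.functionField L a) := by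
  obtain ⟨U, hU, s, rfl⟩ := W.presheaf.exists_germ_eq a
  have hU' : (U : Set W).Nonempty := ⟨_, hU⟩
  simp only [RatFn.functionFieldMap, CommRingCat.hom_comp, RingHom.coe_comp,
    Function.comp_apply]
  rw [TopCat.Presheaf.germ_stalkSpecializes_apply, Scheme.Hom.germ_stalkMap_apply,
    fromSpecExtension_app_apply hU' s, ← CommRingCat.comp_apply,
    extensionIsoSections_hom_germ hU']
  rfl

end

/-! ### The stub -/

/-- **The function field of the normalization of `W` in `L` is `L`**, compatibly with
`K(W) → L`: for an integral scheme `W` and a finite extension `L` of `K(W)` there is a ring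
isomorphism `e : K(W^L) ≃ L` with `e ∘ ι^♯ = (K(W) → L)`, where `ι : W^L → W` is the
normalization morphism and `ι^♯` the induced map of function fields (Liu 2002, Def. 4.1.24 /
Prop. 4.1.25: the normalization `X'` of `X` in `L` has `K(X') = L`). [folklore] -/
theorem stub_functionField_normalizationIn : ∀ (W : Scheme.{0}) [IsIntegral W] (L : Type) [Field L] [Algebra W.functionField L] [FiniteDimensional W.functionField L], ∃ e : (normalizationIn W L).functionField ≃+* L, e.toRingHom.comp (RatFn.functionFieldMap (normalizationInι W L)) = algebraMap W.functionField L := by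
  intro W _ L _ _ _
  -- `q : Spec L → W^L`, a dominant preimmersion with `q ≫ ι = ξ_L`
  let q : Spec (.of L) ⟶ normalizationIn W L := (fromSpecExtension W L).toNormalization
  haveI : IsPreimmersion q := isPreimmersion_toNormalization W L
  haveI : IsDominant q := inferInstanceAs (IsDominant (fromSpecExtension W L).toNormalization)
  have hfac : q ≫ normalizationInι W L = fromSpecExtension W L :=
    Scheme.Hom.toNormalization_fromNormalization _
  -- `e₁ : K(W^L) ≅ K(Spec L)` and `e₂ : L ≅ K(Spec L)`
  let e₁ : (normalizationIn W L).functionField ≃+* (Spec (.of L)).functionField :=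
    RingEquiv.ofBijective (RatFn.functionFieldMap q)
      (functionFieldMap_bijective_of_isPreimmersion q)
  let iL : CommRingCat.of L ⟶ (Spec (.of L)).functionField :=
    (Scheme.ΓSpecIso (.of L)).inv ≫
      (Spec (.of L)).presheaf.germ ⊤ (genericPoint (Spec (.of L))) trivial
  let e₂ : L ≃+* (Spec (.of L)).functionField :=
    RingEquiv.ofBijective iL.hom (bijective_ΓSpecIso_inv_germ L _)
  refine ⟨e₁.trans e₂.symm, ?_⟩
  ext a
  -- functoriality: `q^♯ (ι^♯ a) = ξ_L^♯ a`
  have hcomp : RatFn.functionFieldMap q (RatFn.functionFieldMap (normalizationInι W L) a) =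
      RatFn.functionFieldMap (fromSpecExtension W L) a := by
    rw [← RingHom.comp_apply, ← RatFn.functionFieldMap_comp, functionFieldMap_congr hfac]
  change e₂.symm (RatFn.functionFieldMap q (RatFn.functionFieldMap (normalizationInι W L) a)) =
    algebraMap W.functionField L a
  rw [hcomp, functionFieldMap_fromSpecExtension_apply, RingEquiv.symm_apply_eq]
  rfl

end Summit.ResolutionOfSingularities.ResolutionOfSingularities.Theorems.Picover.FunctionFieldNormalizationIn

end
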